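import Summits.Ventures.Crystal3D.Theorems.StickyWulffConstantCoaxialWallLawEndUniqueMulti
import Summits.Ventures.Crystal3D.Theorems.StickyWulffConstantCoaxialWallLawWordRigidityLetters
import HarnessLib

/-!
# LEMMA X″: bottom-plate and top-plate states of the SAME in-plane root never share a target (two-plate twin count)

HONEST FRAMING. Part of the venture `Summits/Ventures/Crystal3D` (cell `crystal3d-full`), helper for the crux
`CoaxialWallLaw` (stmt-Ventures-19481) of `route-Ventures-StickyWulffConstant`, REGISTERED line `WallLedgerF`
(planner cf-p1), open stub `stub_coaxialTwoSlabAdhesion` (general fillings).  Rung credit only; F-C1 not moved.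
Memo HOME/wall-19481-p2/F-NEXT-SPEC.md §S1 (19481-p2 g4), planner (xxv) "two plates, end balls provably distinct".
LEMMA X (`…EndUniqueMulti.word_target_ne_of_roots_ne`) separates the end pairs of root families `r₁ ≠ ±r₂`.  In the
TWO-PLATE count of a twin pair the top plate's in-plane families, written in the bottom frame system, have the SAME roots
`r` as the bottom families but a different history: a top word's menu chain has the co-axial normal `ν ⟂ r` as its DEEPEST
letter, while a bottom word's deepest letter (if any) is oblique to `r` (well-formedness: `⟪r, μ⟫ = √(2/3)`).  This file
proves that such a pair of states at one ball never has the same target: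

* `word_deepest_cons_of_image_eq_mirror` — letterwise form of `word_frame_eq_cons_of_image_eq_mirror` (B1): if the slot
  dozen of `κ′` is the dozen of `κ` mirrored across `F κ μ`, then the deepest letter of `κ′` is `±` the deepest letter of
  `κ` (or `κ = [a]`, `μ = ±a`, `κ′ = []`), and `κ = []` forces `κ′ = [±μ]`.
* **`word_target_ne_of_root_deepest`** (LEMMA X″) — hypotheses of LEMMA X with equal roots `r`, plus: every deepest
  letter of `κ₁` is NOT orthogonal to `r`, and `κ₂ = l₂ ++ [ν]` with `⟪r, ν⟫ = 0`.  Conclusion `t₁ ≠ t₂`.  Proof: every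
  sub-case of LEMMA X with EQUAL slot images (full/full, shared triangle) is impossible by letterwise rigidity
  (`…WordRigidityLetters`); full/twin by `word_full_twin_false`; in the mirrored twin/twin case rigidity leaves only
  `κ₁ = []`, `κ₂ = [±μ₁]`: both words fresh on a co-axial TERRACE, reading normal `⟂ d₁`, both moves glides, directions
  `d₂ = −d₁` — targets `p ± d₁` differ.

WHAT THIS IS NOT: not the two-plate instance/cell/assembly (memo §S1 L1–L3); F-C1 not moved.
-/

noncomputable section

namespace Summit.Ventures.Crystal3D.Theorems

open Summit.Ventures.Crystal3D Finset
open scoped InnerProductSpace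

section TwoPlates

variable {X : Finset (EuclideanSpace ℝ (Fin 3))}
  {F : List (EuclideanSpace ℝ (Fin 3)) → (EuclideanSpace ℝ (Fin 3) ≃ₗᵢ[ℝ] EuclideanSpace ℝ (Fin 3))}

/-- **Letterwise rigidity, mirrored form.**  See the module docstring. -/
theorem word_deepest_cons_of_image_eq_mirror (hFc : ∀ μ κ, F (μ :: κ) = ((ℝ ∙ μ)ᗮ.reflection).trans (F κ))
    {κ κ' : List (EuclideanSpace ℝ (Fin 3))}
    (hκ : ∀ μ ∈ κ, ‖μ‖ = 1 ∧
      ∀ w ∈ fccSlots, ⟪w, μ⟫_ℝ = 0 ∨ ⟪w, μ⟫_ℝ = Real.sqrt (2 / 3) ∨ ⟪w, μ⟫_ℝ = -Real.sqrt (2 / 3))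
    (hκ' : ∀ μ ∈ κ', ‖μ‖ = 1 ∧
      ∀ w ∈ fccSlots, ⟪w, μ⟫_ℝ = 0 ∨ ⟪w, μ⟫_ℝ = Real.sqrt (2 / 3) ∨ ⟪w, μ⟫_ℝ = -Real.sqrt (2 / 3))
    (hch : List.IsChain (fun μ μ' => ⟪μ, μ'⟫_ℝ = 1 / 3 ∨ ⟪μ, μ'⟫_ℝ = -1 / 3) κ)
    (hch' : List.IsChain (fun μ μ' => ⟪μ, μ'⟫_ℝ = 1 / 3 ∨ ⟪μ, μ'⟫_ℝ = -1 / 3) κ')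
    {μ : EuclideanSpace ℝ (Fin 3)} (hμ1 : ‖μ‖ = 1)
    (hμm : ∀ w ∈ fccSlots, ⟪w, μ⟫_ℝ = 0 ∨ ⟪w, μ⟫_ℝ = Real.sqrt (2 / 3) ∨ ⟪w, μ⟫_ℝ = -Real.sqrt (2 / 3))
    (himg : (F κ' : EuclideanSpace ℝ (Fin 3) → EuclideanSpace ℝ (Fin 3)) '' ↑fccSlots =
      (fun x => F κ x - (2 * ⟪F κ x, F κ μ⟫_ℝ) • F κ μ) '' ↑fccSlots) :
    (κ = [] → ∃ a' : EuclideanSpace ℝ (Fin 3), κ' = [a'] ∧ (a' = μ ∨ a' = -μ)) ∧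
      ∀ (l : List (EuclideanSpace ℝ (Fin 3))) (a : EuclideanSpace ℝ (Fin 3)), κ = l ++ [a] →
        (∃ (l' : List (EuclideanSpace ℝ (Fin 3))) (a' : EuclideanSpace ℝ (Fin 3)),
            κ' = l' ++ [a'] ∧ (a' = a ∨ a' = -a)) ∨
          (l = [] ∧ (μ = a ∨ μ = -a) ∧ κ' = []) := by
  -- the mirrored dozen is the dozen of `μ :: κ`
  have hcons : ∀ x, F (μ :: κ) x = F κ (x - (2 * ⟪x, μ⟫_ℝ) • μ) := fun x => word_F_cons_apply hFc hμ1 κ x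
  have himg' : (F κ' : EuclideanSpace ℝ (Fin 3) → EuclideanSpace ℝ (Fin 3)) '' ↑fccSlots =
      (F (μ :: κ) : EuclideanSpace ℝ (Fin 3) → EuclideanSpace ℝ (Fin 3)) '' ↑fccSlots := by
    rw [himg]
    refine Set.image_congr fun x _ => ?_
    rw [hcons, mirror_conj]
  cases κ with
  | nil =>
    refine ⟨fun _ => ?_, fun l a h => absurd h (by simp)⟩
    have hc1 : ∀ ν ∈ [μ], ‖ν‖ = 1 ∧
        ∀ w ∈ fccSlots, ⟪w, ν⟫_ℝ = 0 ∨ ⟪w, ν⟫_ℝ = Real.sqrt (2 / 3) ∨ ⟪w, ν⟫_ℝ = -Real.sqrt (2 / 3) := by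
      intro ν hν; rw [List.mem_singleton] at hν; subst hν; exact ⟨hμ1, hμm⟩
    obtain ⟨hlen, -⟩ := word_frame_eq_of_image_eq_of_chain hFc hc1 hκ' (List.isChain_singleton μ) hch' himg'.symm
    obtain ⟨-, hlast⟩ := word_deepest_of_image_eq_of_chain hFc hc1 hκ' (List.isChain_singleton μ) hch' himg'.symm
    obtain ⟨l', a', hκ'eq, ha'⟩ := hlast [] μ (by simp)
    have hl' : l' = [] := by
      rw [hκ'eq, List.length_append, List.length_singleton, List.length_singleton] at hlen
      exact List.eq_nil_of_length_eq_zero (by omega)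
    exact ⟨a', by rw [hκ'eq, hl', List.nil_append], ha'⟩
  | cons μ₁ κ₀ =>
    refine ⟨fun h => absurd h (List.cons_ne_nil _ _), fun l a hla => ?_⟩
    have hμ₁1 : ‖μ₁‖ = 1 := (hκ μ₁ (by simp)).1
    have hμ₁m := (hκ μ₁ (by simp)).2
    by_cases hsign : μ = μ₁ ∨ μ = -μ₁
    · -- cancellation: `F (μ :: μ₁ :: κ₀) = F κ₀` as maps
      have hκ₀ : ∀ ν ∈ κ₀, ‖ν‖ = 1 ∧
          ∀ w ∈ fccSlots, ⟪w, ν⟫_ℝ = 0 ∨ ⟪w, ν⟫_ℝ = Real.sqrt (2 / 3) ∨ ⟪w, ν⟫_ℝ = -Real.sqrt (2 / 3) :=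
        fun ν hν => hκ ν (by simp [hν])
      have hch₀ : List.IsChain (fun μ μ' => ⟪μ, μ'⟫_ℝ = 1 / 3 ∨ ⟪μ, μ'⟫_ℝ = -1 / 3) κ₀ := hch.tail
      have hcancel : ∀ x, F (μ :: μ₁ :: κ₀) x = F κ₀ x := by
        intro x
        rw [word_F_cons_apply hFc hμ1, word_F_cons_apply hFc hμ₁1]
        rcases hsign with rfl | rfl
        · rw [reflect_reflect_unit hμ1]
        · rw [reflect_neg_eq, reflect_reflect_unit hμ₁1]
      have himg₀ : (F κ' : EuclideanSpace ℝ (Fin 3) → EuclideanSpace ℝ (Fin 3)) '' ↑fccSlots =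
          (F κ₀ : EuclideanSpace ℝ (Fin 3) → EuclideanSpace ℝ (Fin 3)) '' ↑fccSlots := by
        rw [himg']; exact Set.image_congr fun x _ => hcancel x
      obtain ⟨hnil, hlast⟩ := word_deepest_of_image_eq_of_chain hFc hκ₀ hκ' hch₀ hch' himg₀.symm
      rcases List.eq_nil_or_concat' κ₀ with h0 | ⟨l₀, a₀, h0⟩
      · -- `κ = [μ₁]`: `l = []`, `a = μ₁`, `κ' = []`
        right
        rw [h0] at hla hnil
        have ha : μ₁ = a := by
          have h1 : ([μ₁] : List (EuclideanSpace ℝ (Fin 3))) = [] ++ [μ₁] := rfl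
          rw [h1] at hla
          have := congrArg List.getLast? hla
          rw [List.getLast?_concat, List.getLast?_concat] at this
          exact Option.some.inj this
        have hl : l = [] := by
          have := congrArg List.length hla
          rw [List.length_singleton, List.length_append, List.length_singleton] at this
          exact List.eq_nil_of_length_eq_zero (by omega)
        refine ⟨hl, ?_, hnil.1 rfl⟩
        rw [← ha]; exact hsign
      · -- `κ₀ = l₀ ++ [a₀]`: the deepest letter of `κ` is `a₀ = a`
        left
        obtain ⟨l', a', hκ'eq, ha'⟩ := hlast l₀ a₀ h0
        have haa : a₀ = a := by
          have h1 : μ₁ :: κ₀ = (μ₁ :: l₀) ++ [a₀] := by rw [h0, List.cons_append]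
          rw [h1] at hla
          have := congrArg List.getLast? hla
          rw [List.getLast?_concat, List.getLast?_concat] at this
          exact Option.some.inj this
        rw [haa] at ha'
        exact ⟨l', a', hκ'eq, ha'⟩
    · -- `μ :: κ` is a menu chain with the same deepest letter `a`
      left
      obtain ⟨hne1, hne2⟩ := not_or.1 hsign
      have hc1 : ∀ ν ∈ μ :: μ₁ :: κ₀, ‖ν‖ = 1 ∧
          ∀ w ∈ fccSlots, ⟪w, ν⟫_ℝ = 0 ∨ ⟪w, ν⟫_ℝ = Real.sqrt (2 / 3) ∨ ⟪w, ν⟫_ℝ = -Real.sqrt (2 / 3) := by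
        intro ν hν
        rcases List.mem_cons.1 hν with rfl | hν
        · exact ⟨hμ1, hμm⟩
        · exact hκ ν hν
      have hjunction : ⟪μ, μ₁⟫_ℝ = 1 / 3 ∨ ⟪μ, μ₁⟫_ℝ = -1 / 3 :=
        menuNormals_chain_of_ne_of_ne_neg hμ1 hμ₁1 hμm hμ₁m hne1 (fun h => hne2 (by rw [h, neg_neg]))
      have hchc : List.IsChain (fun μ μ' => ⟪μ, μ'⟫_ℝ = 1 / 3 ∨ ⟪μ, μ'⟫_ℝ = -1 / 3) (μ :: μ₁ :: κ₀) :=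
        hch.cons_cons hjunction
      obtain ⟨-, hlast⟩ := word_deepest_of_image_eq_of_chain hFc hc1 hκ' hchc hch' himg'.symm
      have h1 : μ :: μ₁ :: κ₀ = (μ :: l) ++ [a] := by rw [List.cons_append, hla]
      exact hlast (μ :: l) a h1

/-- **LEMMA X″.**  A bottom-plate state and a top-plate state of the same in-plane root at one ball have different
targets.  See the module docstring. -/
theorem word_target_ne_of_root_deepest (hX : ∀ p ∈ X, ∀ q ∈ X, p ≠ q → 1 ≤ dist p q)
    (hFc : ∀ μ κ, F (μ :: κ) = ((ℝ ∙ μ)ᗮ.reflection).trans (F κ))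
    {κ₁ κ₂ : List (EuclideanSpace ℝ (Fin 3))}
    (hκ₁ : ∀ μ ∈ κ₁, ‖μ‖ = 1 ∧
      ∀ w ∈ fccSlots, ⟪w, μ⟫_ℝ = 0 ∨ ⟪w, μ⟫_ℝ = Real.sqrt (2 / 3) ∨ ⟪w, μ⟫_ℝ = -Real.sqrt (2 / 3))
    (hκ₂ : ∀ μ ∈ κ₂, ‖μ‖ = 1 ∧
      ∀ w ∈ fccSlots, ⟪w, μ⟫_ℝ = 0 ∨ ⟪w, μ⟫_ℝ = Real.sqrt (2 / 3) ∨ ⟪w, μ⟫_ℝ = -Real.sqrt (2 / 3))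
    (hch₁ : List.IsChain (fun μ μ' => ⟪μ, μ'⟫_ℝ = 1 / 3 ∨ ⟪μ, μ'⟫_ℝ = -1 / 3) κ₁)
    (hch₂ : List.IsChain (fun μ μ' => ⟪μ, μ'⟫_ℝ = 1 / 3 ∨ ⟪μ, μ'⟫_ℝ = -1 / 3) κ₂)
    {r : EuclideanSpace ℝ (Fin 3)} (hr : r ∈ fccSlots)
    (hdeep₁ : ∀ (l : List (EuclideanSpace ℝ (Fin 3))) (μ : EuclideanSpace ℝ (Fin 3)), κ₁ = l ++ [μ] → ⟪r, μ⟫_ℝ ≠ 0)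
    {l₂ : List (EuclideanSpace ℝ (Fin 3))} {ν : EuclideanSpace ℝ (Fin 3)} (hκ₂ν : κ₂ = l₂ ++ [ν]) (hν : ⟪r, ν⟫_ℝ = 0)
    {d₁ d₂ : EuclideanSpace ℝ (Fin 3)} (hd₁ : d₁ = F κ₁ (((-1 : ℝ) ^ κ₁.length) • r))
    (hd₂ : d₂ = F κ₂ (((-1 : ℝ) ^ κ₂.length) • r))
    {p t₁ t₂ : EuclideanSpace ℝ (Fin 3)}
    (hT₁ : ((∀ w ∈ fccSlots, p + F κ₁ w ∈ X) ∧ t₁ = p + d₁) ∨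
      ∃ m : EuclideanSpace ℝ (Fin 3), ‖m‖ = 1 ∧
        (∀ w ∈ fccSlots, ⟪F κ₁ w, m⟫_ℝ = 0 ∨ ⟪F κ₁ w, m⟫_ℝ = Real.sqrt (2 / 3) ∨ ⟪F κ₁ w, m⟫_ℝ = -Real.sqrt (2 / 3)) ∧
        (∀ w ∈ fccSlots, ⟪F κ₁ w, m⟫_ℝ ≤ 0 → p + F κ₁ w ∈ X) ∧
        (∀ w ∈ fccSlots, ⟪F κ₁ w, m⟫_ℝ < 0 → p + (F κ₁ w - (2 * ⟪F κ₁ w, m⟫_ℝ) • m) ∈ X) ∧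
        (∀ w ∈ fccSlots, 0 < ⟪F κ₁ w, m⟫_ℝ → p + F κ₁ w ∉ X) ∧
        ((⟪d₁, m⟫_ℝ = Real.sqrt (2 / 3) ∧ t₁ = p - (d₁ - (2 * ⟪d₁, m⟫_ℝ) • m)) ∨ (⟪d₁, m⟫_ℝ = 0 ∧ t₁ = p + d₁)))
    (hT₂ : ((∀ w ∈ fccSlots, p + F κ₂ w ∈ X) ∧ t₂ = p + d₂) ∨
      ∃ m : EuclideanSpace ℝ (Fin 3), ‖m‖ = 1 ∧
        (∀ w ∈ fccSlots, ⟪F κ₂ w, m⟫_ℝ = 0 ∨ ⟪F κ₂ w, m⟫_ℝ = Real.sqrt (2 / 3) ∨ ⟪F κ₂ w, m⟫_ℝ = -Real.sqrt (2 / 3)) ∧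
        (∀ w ∈ fccSlots, ⟪F κ₂ w, m⟫_ℝ ≤ 0 → p + F κ₂ w ∈ X) ∧
        (∀ w ∈ fccSlots, ⟪F κ₂ w, m⟫_ℝ < 0 → p + (F κ₂ w - (2 * ⟪F κ₂ w, m⟫_ℝ) • m) ∈ X) ∧
        (∀ w ∈ fccSlots, 0 < ⟪F κ₂ w, m⟫_ℝ → p + F κ₂ w ∉ X) ∧
        ((⟪d₂, m⟫_ℝ = Real.sqrt (2 / 3) ∧ t₂ = p - (d₂ - (2 * ⟪d₂, m⟫_ℝ) • m)) ∨ (⟪d₂, m⟫_ℝ = 0 ∧ t₂ = p + d₂))) :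
    t₁ ≠ t₂ := by
  have hr0 : 0 < Real.sqrt (2 / 3) := Real.sqrt_pos.2 (by norm_num)
  have hκ₂ne : κ₂ ≠ [] := by rw [hκ₂ν]; simp
  have hνlast : ∀ (l' : List (EuclideanSpace ℝ (Fin 3))) (a' : EuclideanSpace ℝ (Fin 3)), κ₂ = l' ++ [a'] → a' = ν := by
    intro l' a' h
    rw [hκ₂ν] at h
    have := congrArg List.getLast? h
    rw [List.getLast?_concat, List.getLast?_concat] at this
    exact (Option.some.inj this).symm
  -- a letter equal or antipodal to a deepest letter of `κ₁` is not orthogonal to `r`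
  have hobl : ∀ (l : List (EuclideanSpace ℝ (Fin 3))) (μ a' : EuclideanSpace ℝ (Fin 3)), κ₁ = l ++ [μ] →
      (a' = μ ∨ a' = -μ) → ⟪r, a'⟫_ℝ ≠ 0 := by
    intro l μ a' h ha' h0
    refine hdeep₁ l μ h ?_
    rcases ha' with rfl | rfl
    · exact h0
    · rw [inner_neg_right, neg_eq_zero] at h0; exact h0
  -- (1) the two slot dozens are never EQUAL
  have hexcl : (F κ₁ : EuclideanSpace ℝ (Fin 3) → EuclideanSpace ℝ (Fin 3)) '' ↑fccSlots =
      (F κ₂ : EuclideanSpace ℝ (Fin 3) → EuclideanSpace ℝ (Fin 3)) '' ↑fccSlots → False := by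
    intro himg
    obtain ⟨hnil, hlast⟩ := word_deepest_of_image_eq_of_chain hFc hκ₁ hκ₂ hch₁ hch₂ himg
    rcases List.eq_nil_or_concat' κ₁ with h0 | ⟨l₁, μ, h1⟩
    · exact hκ₂ne (hnil.1 h0)
    · obtain ⟨l', a', hκ₂', ha'⟩ := hlast l₁ μ h1
      have hνa : a' = ν := hνlast l' a' hκ₂'
      rw [hνa] at ha'
      exact hobl l₁ μ ν h1 ha' hν
  have htri_img : ∀ {a b c : EuclideanSpace ℝ (Fin 3)}, a ∈ fccSlots → b ∈ fccSlots → c ∈ fccSlots →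
      ⟪a, b⟫_ℝ = 1 / 2 → ⟪a, c⟫_ℝ = 1 / 2 → ⟪b, c⟫_ℝ = 1 / 2 →
      (∃ w ∈ fccSlots, F κ₁ w = F κ₂ a) → (∃ w ∈ fccSlots, F κ₁ w = F κ₂ b) → (∃ w ∈ fccSlots, F κ₁ w = F κ₂ c) →
      False := by
    intro a b c ha hb hc iab iac ibc ea eb ec
    obtain ⟨w₁, hw₁, e₁⟩ := ea
    obtain ⟨w₂, hw₂, e₂⟩ := eb
    obtain ⟨w₃, hw₃, e₃⟩ := ec
    exact hexcl (image_fccSlots_eq_of_triangle (F κ₂) (F κ₁) ha hb hc iab iac ibc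
      ⟨w₁, Finset.mem_coe.2 hw₁, e₁⟩ ⟨w₂, Finset.mem_coe.2 hw₂, e₂⟩ ⟨w₃, Finset.mem_coe.2 hw₃, e₃⟩).symm
  intro heq
  rcases hT₁ with ⟨full₁, rfl⟩ | ⟨m₁, hm₁, menu₁, own₁, mir₁, emp₁, hc₁⟩ <;>
    rcases hT₂ with ⟨full₂, ht₂⟩ | ⟨m₂, hm₂, menu₂, own₂, mir₂, emp₂, hc₂⟩
  · -- full / full: equal dozens — excluded
    obtain ⟨n, hn, hnmenu, -⟩ := exists_menuNormal_far (F κ₂) hr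
    obtain ⟨a, ha, b, hb, c, hc, -, -, -, iab, iac, ibc, -, -⟩ := exists_far_frame (F κ₂) hn hnmenu
    have hocc : ∀ {x : EuclideanSpace ℝ (Fin 3)}, x ∈ fccSlots → ∃ w ∈ fccSlots, F κ₁ w = F κ₂ x := fun {x} hx =>
      shell_slot_of_full hX (F κ₁) full₁ (full₂ x hx) (by rw [LinearIsometryEquiv.norm_map, norm_eq_one_of_mem_fccSlots hx])
    exact htri_img ha hb hc iab iac ibc (hocc ha) (hocc hb) (hocc hc)
  · -- full / twin
    exact word_full_twin_false hX hFc hκ₁ hκ₂ hch₁ hch₂ full₁ hm₂ menu₂ own₂ emp₂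
  · -- twin / full
    exact word_full_twin_false hX hFc hκ₂ hκ₁ hch₂ hch₁ full₂ hm₁ menu₁ own₁ emp₁
  · -- twin / twin: the occupied negative face of `m₂` inside the `(F κ₁, m₁)` reading
    have hm₂' : ‖-m₂‖ = 1 := by rw [norm_neg, hm₂]
    obtain ⟨a, ha, b, hb, c, hc, hna, hnb, hnc, iab, iac, ibc, -, -⟩ :=
      exists_far_frame (F κ₂) hm₂' (menu_neg (F κ₂) menu₂)
    have hoccX : ∀ {x : EuclideanSpace ℝ (Fin 3)}, x ∈ fccSlots → ⟪F κ₂ x, -m₂⟫_ℝ = Real.sqrt (2 / 3) → p + F κ₂ x ∈ X := by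
      intro x hx hxm
      rw [inner_neg_right] at hxm
      exact own₂ x hx (by linarith)
    have hmc : ∀ x, F κ₁ x - (2 * ⟪F κ₁ x, m₁⟫_ℝ) • m₁ = F κ₁ (x - (2 * ⟪x, (F κ₁).symm m₁⟫_ℝ) • (F κ₁).symm m₁) := by
      intro x
      have := mirror_conj (F κ₁) ((F κ₁).symm m₁) x
      rwa [LinearIsometryEquiv.apply_symm_apply] at this
    rcases triangle_own_or_mirror_of_twinDozen hX (F κ₁) hm₁ menu₁ own₁ mir₁ (F κ₂) ha hb hc iab iac ibc
        (hoccX ha hna) (hoccX hb hnb) (hoccX hc hnc) with ⟨ea, eb, ec⟩ | ⟨ea, eb, ec⟩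
    · -- (a) own: equal dozens — excluded
      exact htri_img ha hb hc iab iac ibc ea eb ec
    · -- (b) mirrored: `F κ₂ ≃ μ₁ :: κ₁`; letterwise rigidity leaves only the fresh terrace case
      set μ₁ : EuclideanSpace ℝ (Fin 3) := (F κ₁).symm m₁ with hμ₁
      have hFμ : F κ₁ μ₁ = m₁ := by rw [hμ₁, LinearIsometryEquiv.apply_symm_apply]
      have hμ₁1 : ‖μ₁‖ = 1 := by rw [hμ₁, LinearIsometryEquiv.norm_map, hm₁]
      have hμ₁m : ∀ w ∈ fccSlots, ⟪w, μ₁⟫_ℝ = 0 ∨ ⟪w, μ₁⟫_ℝ = Real.sqrt (2 / 3) ∨ ⟪w, μ₁⟫_ℝ = -Real.sqrt (2 / 3) := by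
        intro w hw; rw [← LinearIsometryEquiv.inner_map_map (F κ₁) w μ₁, hFμ]; exact menu₁ w hw
      have himg : (F κ₂ : EuclideanSpace ℝ (Fin 3) → EuclideanSpace ℝ (Fin 3)) '' ↑fccSlots =
          (fun x => F κ₁ x - (2 * ⟪F κ₁ x, F κ₁ μ₁⟫_ℝ) • F κ₁ μ₁) '' ↑fccSlots := by
        rw [image_fccSlots_eq_of_triangle (F κ₂) ((F κ₁).trans (ℝ ∙ m₁)ᗮ.reflection) ha hb hc iab iac ibc ea eb ec, hFμ]
        exact Set.image_congr fun x _ => by rw [LinearIsometryEquiv.trans_apply, reflection_unit_apply hm₁]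
      obtain ⟨hpar, hmap⟩ := word_frame_eq_cons_of_image_eq_mirror hFc hκ₁ hκ₂ hch₁ hch₂ hμ₁1 hμ₁m himg
      obtain ⟨hdeep0, hdeepc⟩ := word_deepest_cons_of_image_eq_mirror hFc hκ₁ hκ₂ hch₁ hch₂ hμ₁1 hμ₁m himg
      -- `κ₁` must be empty
      have hκ₁0 : κ₁ = [] := by
        rcases List.eq_nil_or_concat' κ₁ with h0 | ⟨l₁, μ, h1⟩
        · exact h0
        · exfalso
          rcases hdeepc l₁ μ h1 with ⟨l', a', hκ₂', ha'⟩ | ⟨-, -, h20⟩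
          · have hνa : a' = ν := hνlast l' a' hκ₂'
            rw [hνa] at ha'
            exact hobl l₁ μ ν h1 ha' hν
          · exact hκ₂ne h20
      -- hence `κ₂ = [±μ₁]`, `ν = ±μ₁`, and the reading normal is orthogonal to `d₁`
      obtain ⟨a', hκ₂a, ha'⟩ := hdeep0 hκ₁0
      have hνa : a' = ν := hνlast [] a' (by rw [hκ₂a, List.nil_append])
      rw [hνa] at ha'
      have hd₁r : d₁ = F κ₁ r := by rw [hd₁, hκ₁0, List.length_nil, pow_zero, one_smul]
      have hx0 : ⟪d₁, m₁⟫_ℝ = 0 := by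
        rw [hd₁r, ← hFμ, LinearIsometryEquiv.inner_map_map]
        rcases ha' with h | h
        · rw [← h]; exact hν
        · have : μ₁ = -ν := by rw [h, neg_neg]
          rw [this, inner_neg_right, hν, neg_zero]
      have hmap' : ∀ x, F κ₂ x = F κ₁ x - (2 * ⟪F κ₁ x, m₁⟫_ℝ) • m₁ := fun x => by rw [hmap x, ← hmc x]
      -- the reading normal of the second state is `−m₁`
      have hm₁' : ‖-m₁‖ = 1 := by rw [norm_neg, hm₁]
      have hmm : -m₁ = m₂ := by
        refine twinDozen_normal_eq_self (F κ₂) hm₁' hm₂ ?_ menu₂ ?_ emp₂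
        · intro w hw
          rw [hmap' w, inner_neg_right, inner_mirror_self hm₁, neg_neg]; exact menu₁ w hw
        · intro w hw hle
          rw [hmap' w, inner_neg_right, inner_mirror_self hm₁, neg_neg] at hle
          rw [hmap' w]
          rcases lt_or_eq_of_le hle with hlt | h0
          · exact mir₁ w hw hlt
          · rw [h0, mul_zero, zero_smul, sub_zero]; exact own₁ w hw hle
      rw [← hmm] at hc₂
      -- `d₂ = −d₁`
      have hlen₂ : κ₂.length = 1 := by rw [hκ₂a, List.length_singleton]
      have hd₂' : d₂ = -d₁ := by
        rw [hd₂, hlen₂, pow_one, neg_one_smul, map_neg, hmap', ← hd₁r, hx0, mul_zero, zero_smul, sub_zero]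
      have hd₁0 : d₁ ≠ 0 := by
        rw [hd₁r]; intro h
        have := norm_eq_one_of_mem_fccSlots hr
        rw [← LinearIsometryEquiv.norm_map (F κ₁) r, h, norm_zero] at this
        exact zero_ne_one this
      rcases hc₁ with ⟨hx₁, -⟩ | ⟨-, rfl⟩
      · rw [hx0] at hx₁; exact hr0.ne hx₁
      rcases hc₂ with ⟨hx₂, -⟩ | ⟨-, rfl⟩
      · rw [hd₂', inner_neg_left, inner_neg_right, neg_neg, hx0] at hx₂; exact hr0.ne hx₂
      -- glide / glide: `p + d₁ = p − d₁`
      rw [hd₂'] at heq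
      have h2 : d₁ = -d₁ := add_left_cancel heq
      have : (2 : ℝ) • d₁ = 0 := by rw [two_smul]; nth_rewrite 2 [h2]; exact add_neg_cancel d₁
      exact hd₁0 (by simpa using this)

end TwoPlates

end Summit.Ventures.Crystal3D.Theorems

end
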